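import Mathlib

/-!
# Power certificates: the pencil theorem over every field from `(1 - t²)^i`-certificates, and the "blocks + top" class

Helper file for crux `stmt-CriticalPhenomena-4575` (`NoHeavyLowerTail`, route `PercNearOneGluingNoHeavy`),
new-inequality factory seat `prim-ineq-gen-3` (gen 23).  Everything here is PROVED; no definitions.

Notation (memo `run/shared/lean/prim/prim-ineq-gen-3/CONJECTURE-P2.md`): `D = 𝒜 \\ 𝒜`, pencil column
`u^E(t) = z^E + t y^E` with `z^E(C) = [E ⊆ C]`, `y^E(C) = [E ∩ C = ∅]`.  A POWER CERTIFICATE of exponent `i` for a member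
`A` is a family of coefficients `γ_E` (allowed to depend on `t`) with `∑_E γ_E u^E(t) = (1 - t²)^i δ_A` on the members.
Gen 22's `linearIndependent_pencil_of_certificates` is the case `i = 1` with `γ = p - t q` for a reciprocal pair `(p, q)`.

WHY (gen 23, memo FINDINGS-gen23.md): reciprocal (degree-1, exponent-1) certificates exist over every FIELD but NOT over `ℤ`
in general — for `𝒮_r = {{1},…,{r},[r]}`, `r ≥ 4`, every rational certificate of the top has the coefficient `-1/(r-1)` at
the column `∅`, and P2 holds in characteristic `p ∣ r - 1` for a different reason (`μ = -λ`).  But an INTEGRAL certificate of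
exponent 2 exists: `c_∅ = (1+t)(1+(r-2)t+t²)`, `c_{B} = -(1+t)²`, `c_{S∖B} = (1-t)(1+t)²`.  Hence:

* `linearIndependent_pencil_of_power_certificates` — if every nonempty sub-family `ℬ ⊆ 𝒜` has a member with a power
  certificate (any exponent) over `ℬ \\ ℬ` at the given `t`, then the pencil rows of `𝒜` are independent at `t` whenever
  `t * t ≠ 1`.  [Pair a dependency `c` with the certificate of its support: `(1 - t²)^i c_A = 0`.]
* `linearIndependent_pencil_of_blocks_top` — ★ the pencil theorem over EVERY field for the families
  `{B_1, …, B_r, S}`: pairwise disjoint nonempty blocks together with a top `S` strictly containing the union of any two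
  blocks (e.g. the classes of an equivalence relation on `S` with at least three classes, together with `S`; or `𝒮_r`).
  These families are neither union-closed nor intersection-closed, framed, down-closed or almost-disjoint, and for `r ≥ 4` they have no
  integral reciprocal certificate at all; the proof uses the explicit integral exponent-2 certificate above for the top and
  exponent-1 certificates `(-t) e_∅ + (1+t) e_{S∖B}`, `(-t) e_∅ + (1+t) e_B`, `(1-t) e_∅` for the degenerate sub-families.
(prim-ineq-gen-3 gen 23, 2026-08-24.)
-/

namespace Summit.CriticalPhenomena.PercolationContinuityZ3.Theorems

namespace OrderedDifferences

open Finset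
open scoped FinsetFamily

variable {α : Type*} [DecidableEq α] {K : Type*} [Field K]

/-- Fubini step: pairing a pointwise dependency with a coefficient vector `γ` on the columns. -/
private theorem pair_power_aux (ℬ : Finset (Finset α)) (c' γ : Finset α → K) (t : K) :
    ∑ E ∈ ℬ \\ ℬ, γ E * ∑ C ∈ ℬ, c' C * ((if E ⊆ C then (1 : K) else 0) +
        t * (if Disjoint E C then (1 : K) else 0)) =
      ∑ C ∈ ℬ, c' C * ∑ E ∈ ℬ \\ ℬ, γ E * ((if E ⊆ C then (1 : K) else 0) +
        t * (if Disjoint E C then (1 : K) else 0)) := by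
  calc ∑ E ∈ ℬ \\ ℬ, γ E * ∑ C ∈ ℬ, c' C * ((if E ⊆ C then (1 : K) else 0) +
          t * (if Disjoint E C then (1 : K) else 0))
      = ∑ E ∈ ℬ \\ ℬ, ∑ C ∈ ℬ, γ E * (c' C * ((if E ⊆ C then (1 : K) else 0) +
          t * (if Disjoint E C then (1 : K) else 0))) := by
        refine sum_congr rfl fun E _ => ?_
        rw [mul_sum]
    _ = ∑ C ∈ ℬ, ∑ E ∈ ℬ \\ ℬ, γ E * (c' C * ((if E ⊆ C then (1 : K) else 0) +
          t * (if Disjoint E C then (1 : K) else 0))) := sum_comm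
    _ = ∑ C ∈ ℬ, c' C * ∑ E ∈ ℬ \\ ℬ, γ E * ((if E ⊆ C then (1 : K) else 0) +
          t * (if Disjoint E C then (1 : K) else 0)) := by
        refine sum_congr rfl fun C _ => ?_
        rw [mul_sum]
        exact sum_congr rfl fun E _ => by ring

/-- **Power certificates for one member of every sub-family give the pencil theorem.**  Fix `t ∈ K` with `t * t ≠ 1`.
If every nonempty `ℬ ⊆ 𝒜` has a member `A`, an exponent `i` and coefficients `γ` on `ℬ \\ ℬ` with
`∑_E γ_E ([E ⊆ C] + t [E ∩ C = ∅]) = (1 - t²)^i [C = A]` for all `C ∈ ℬ`, then the pencil rows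
`C ↦ (E ↦ [E ⊆ C] + t [E ∩ C = ∅])` of `𝒜` over `𝒜 \\ 𝒜` are linearly independent over `K`. -/
theorem linearIndependent_pencil_of_power_certificates (𝒜 : Finset (Finset α)) {t : K} (ht : t * t ≠ 1)
    (hcert : ∀ ℬ ⊆ 𝒜, ℬ.Nonempty → ∃ A ∈ ℬ, ∃ i : ℕ, ∃ γ : Finset α → K,
        ∀ C ∈ ℬ, ∑ E ∈ ℬ \\ ℬ, γ E * ((if E ⊆ C then (1 : K) else 0) +
          t * (if Disjoint E C then (1 : K) else 0)) = (1 - t * t) ^ i * (if C = A then 1 else 0)) :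
    LinearIndependent K (fun A : 𝒜 => fun E : (𝒜 \\ 𝒜 : Finset (Finset α)) =>
      (if (E : Finset α) ⊆ (A : Finset α) then (1 : K) else 0) +
        t * (if Disjoint (E : Finset α) (A : Finset α) then (1 : K) else 0)) := by
  classical
  rw [Fintype.linearIndependent_iff]
  intro c hc A₀
  let c' : Finset α → K := fun C => if h : C ∈ 𝒜 then c ⟨C, h⟩ else 0
  have hc' : ∀ A : 𝒜, c' A = c A := fun A => by simp only [c', dif_pos A.2]
  -- pointwise form of the dependency, as a sum over `𝒜`
  have hdep : ∀ E ∈ 𝒜 \\ 𝒜, ∑ C ∈ 𝒜, c' C * ((if E ⊆ C then (1 : K) else 0) +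
      t * (if Disjoint E C then (1 : K) else 0)) = 0 := by
    intro E hE
    have h := congr_fun hc ⟨E, hE⟩
    simp only [Finset.sum_apply, Pi.smul_apply, smul_eq_mul, Pi.zero_apply] at h
    have h' : ∑ x ∈ 𝒜.attach, c x * ((if E ⊆ (x : Finset α) then (1 : K) else 0) +
        t * (if Disjoint E (x : Finset α) then (1 : K) else 0)) = 0 := by
      rwa [← univ_eq_attach]
    rw [← sum_attach 𝒜]
    exact (sum_congr rfl fun A _ => by rw [hc' A]).trans h'
  by_contra hA₀
  -- the support sub-family
  set ℬ : Finset (Finset α) := 𝒜.filter (fun C => c' C ≠ 0) with hℬdef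
  have hℬsub : ℬ ⊆ 𝒜 := filter_subset _ _
  have hℬne : ℬ.Nonempty := ⟨A₀, mem_filter.mpr ⟨A₀.2, by rw [hc' A₀]; exact hA₀⟩⟩
  obtain ⟨A, hA, i, γ, hγ⟩ := hcert ℬ hℬsub hℬne
  have hDsub : ℬ \\ ℬ ⊆ 𝒜 \\ 𝒜 := diffs_subset hℬsub hℬsub
  have hdepB : ∀ E ∈ ℬ \\ ℬ, ∑ C ∈ ℬ, c' C * ((if E ⊆ C then (1 : K) else 0) +
      t * (if Disjoint E C then (1 : K) else 0)) = 0 := by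
    intro E hE
    rw [hℬdef, sum_filter_of_ne (fun C _ h => by
      intro h0; rw [h0, zero_mul] at h; exact h rfl)]
    exact hdep E (hDsub hE)
  -- pair the dependency with the certificate
  have e : ∑ E ∈ ℬ \\ ℬ, γ E * ∑ C ∈ ℬ, c' C * ((if E ⊆ C then (1 : K) else 0) +
      t * (if Disjoint E C then (1 : K) else 0)) = 0 :=
    sum_eq_zero fun E hE => by rw [hdepB E hE, mul_zero]
  rw [pair_power_aux] at e
  have e2 : ∑ C ∈ ℬ, c' C * ∑ E ∈ ℬ \\ ℬ, γ E * ((if E ⊆ C then (1 : K) else 0) +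
      t * (if Disjoint E C then (1 : K) else 0)) = (1 - t * t) ^ i * c' A := by
    calc ∑ C ∈ ℬ, c' C * ∑ E ∈ ℬ \\ ℬ, γ E * ((if E ⊆ C then (1 : K) else 0) +
          t * (if Disjoint E C then (1 : K) else 0))
        = ∑ C ∈ ℬ, c' C * ((1 - t * t) ^ i * (if C = A then (1 : K) else 0)) :=
          sum_congr rfl fun C hC => by rw [hγ C hC]
      _ = ∑ C ∈ ℬ, (if C = A then (1 - t * t) ^ i * c' C else 0) := by
          refine sum_congr rfl fun C _ => ?_
          by_cases h : C = A
          · rw [if_pos h, if_pos h]; ring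
          · rw [if_neg h, if_neg h]; ring
      _ = (1 - t * t) ^ i * c' A := by rw [sum_ite_eq', if_pos hA]
  rw [e2] at e
  have hcA : c' A ≠ 0 := (mem_filter.mp hA).2
  rcases mul_eq_zero.mp e with h4 | h4
  · exact ht (by
      have h5 : 1 - t * t = 0 := pow_eq_zero_iff (n := i) (by
        rintro rfl; simp at h4) |>.mp h4
      linear_combination -h5)
  · exact hcA h4

/-- Evaluation of a single indicator coefficient against a test function on the columns. -/
private theorem sum_ite_col (𝒟 : Finset (Finset α)) (X : Finset α) (hX : X ∈ 𝒟) (a : K) (g : Finset α → K) :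
    ∑ W ∈ 𝒟, (if W = X then a else 0) * g W = a * g X := by
  simp_rw [ite_mul, zero_mul]
  rw [sum_ite_eq' 𝒟 X, if_pos hX]

/-- `∑_{B ∈ ℬ} (if B = C then x else y) = x + (#ℬ - 1) y` for `C ∈ ℬ`. -/
private theorem sum_ite_eq_add_card (ℬ : Finset (Finset α)) (C : Finset α) (hC : C ∈ ℬ) (x y : K) :
    ∑ B ∈ ℬ, (if B = C then x else y) = x + ((#ℬ : K) - 1) * y := by
  rw [← insert_erase hC, sum_insert (notMem_erase C ℬ), if_pos rfl,
    sum_congr rfl fun B hB => if_neg (ne_of_mem_erase hB), sum_const, nsmul_eq_mul,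
    card_insert_of_notMem (notMem_erase C ℬ), card_erase_of_mem hC]
  have h1 : 1 ≤ #ℬ := card_pos.mpr ⟨C, hC⟩
  rw [Nat.sub_add_cancel h1, Nat.cast_sub h1, Nat.cast_one]

omit [DecidableEq α] in
/-- `∑_{W} (∑_{B ∈ ℬ'} f B W) * g W = ∑_{B ∈ ℬ'} ∑_W f B W * g W`. -/
private theorem sum_sum_col (𝒟 ℬ' : Finset (Finset α)) (f : Finset α → Finset α → K) (g : Finset α → K) :
    ∑ W ∈ 𝒟, (∑ B ∈ ℬ', f B W) * g W = ∑ B ∈ ℬ', ∑ W ∈ 𝒟, f B W * g W := by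
  rw [sum_comm]
  exact sum_congr rfl fun W _ => by rw [sum_mul]

/-- **The pencil theorem over every field for "blocks + top" families.**  Let `ℬ` be a family of pairwise disjoint
nonempty sets and `S` a set strictly containing `B ∪ B'` for all `B, B' ∈ ℬ` (for `B = B'`: every block is a proper
subset of `S`).  Then for the family `𝒜 = ℬ ∪ {S}` and every `t ∈ K` with `t * t ≠ 1`, the pencil rows
`C ↦ (E ↦ [E ⊆ C] + t [E ∩ C = ∅])` over `𝒜 \\ 𝒜` are linearly independent over `K`.  (For `ℬ` = four or more
singletons no integral reciprocal certificate exists; the top is certified by the integral exponent-2 certificate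
`c_∅ = (1+t)(1+(r-2)t+t²)`, `c_B = -(1+t)²`, `c_{S∖B} = (1-t)(1+t)²`, `r = #blocks`.) -/
theorem linearIndependent_pencil_of_blocks_top (ℬ : Finset (Finset α)) (S : Finset α)
    (hne : ∀ B ∈ ℬ, B.Nonempty) (hdisj : ∀ B ∈ ℬ, ∀ B' ∈ ℬ, B ≠ B' → Disjoint B B')
    (hS : ∀ B ∈ ℬ, ∀ B' ∈ ℬ, B ∪ B' ⊂ S) {t : K} (ht : t * t ≠ 1) :
    LinearIndependent K (fun A : (insert S ℬ : Finset (Finset α)) =>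
      fun E : ((insert S ℬ) \\ (insert S ℬ) : Finset (Finset α)) =>
      (if (E : Finset α) ⊆ (A : Finset α) then (1 : K) else 0) +
        t * (if Disjoint (E : Finset α) (A : Finset α) then (1 : K) else 0)) := by
  classical
  -- basic facts about blocks
  have hBS : ∀ B ∈ ℬ, B ⊂ S := fun B hB => by simpa using hS B hB B hB
  have F1 : ∀ B ∈ ℬ, ∀ C ∈ ℬ, B ⊆ C ↔ B = C := by
    intro B hB C hC
    refine ⟨fun h => ?_, fun h => h ▸ subset_rfl⟩
    by_contra hBC
    have hd := hdisj B hB C hC hBC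
    exact (hne B hB).ne_empty (disjoint_self.mp (hd.mono_right h))
  have F2 : ∀ B ∈ ℬ, ∀ C ∈ ℬ, Disjoint B C ↔ B ≠ C := by
    intro B hB C hC
    refine ⟨fun h hBC => ?_, hdisj B hB C hC⟩
    subst hBC
    exact (hne B hB).ne_empty (disjoint_self.mp h)
  have F3 : ∀ B ∈ ℬ, ∀ C ∈ ℬ, ¬ (S \ B ⊆ C) := by
    intro B hB C hC h
    have h2 : S ⊆ B ∪ C := fun x hx => by
      by_cases hxB : x ∈ B
      · exact mem_union_left _ hxB
      · exact mem_union_right _ (h (mem_sdiff.mpr ⟨hx, hxB⟩))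
    exact not_subset_of_ssubset (hS B hB C hC) h2
  have F4 : ∀ B ∈ ℬ, ∀ C ∈ ℬ, Disjoint (S \ B) C ↔ B = C := by
    intro B hB C hC
    have hCS : C ⊆ S := (hBS C hC).subset
    constructor
    · intro h
      have hCB : C ⊆ B := fun x hx => by
        by_contra hxB
        exact disjoint_left.mp h (mem_sdiff.mpr ⟨hCS hx, hxB⟩) hx
      exact ((F1 C hC B hB).mp hCB).symm
    · rintro rfl
      exact disjoint_sdiff_self_left
  have F5 : ∀ B ∈ ℬ, ¬ Disjoint B S := fun B hB h =>
    (hne B hB).ne_empty (disjoint_self.mp (h.mono_right (hBS B hB).subset))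
  have F6 : ∀ B ∈ ℬ, ¬ Disjoint (S \ B) S := fun B hB h => by
    have hne' : (S \ B).Nonempty := sdiff_nonempty.mpr (not_subset_of_ssubset (hBS B hB))
    exact hne'.ne_empty (disjoint_self.mp (h.mono_right sdiff_subset))
  refine linearIndependent_pencil_of_power_certificates (insert S ℬ) ht fun 𝒞 h𝒞 h𝒞ne => ?_
  have h0 : (∅ : Finset α) ∈ 𝒞 \\ 𝒞 := by
    obtain ⟨C, hC⟩ := h𝒞ne
    exact mem_diffs.mpr ⟨C, hC, C, hC, by simp⟩
  -- a singleton sub-family `{A}`: certificate `(1 - t) e_∅`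
  have single : ∀ A ∈ 𝒞, (∀ C ∈ 𝒞, C = A) → ∃ A ∈ 𝒞, ∃ i : ℕ, ∃ γ : Finset α → K,
      ∀ C ∈ 𝒞, ∑ E ∈ 𝒞 \\ 𝒞, γ E * ((if E ⊆ C then (1 : K) else 0) +
        t * (if Disjoint E C then (1 : K) else 0)) = (1 - t * t) ^ i * (if C = A then 1 else 0) := by
    intro A hA hall
    refine ⟨A, hA, 1, fun W => if W = ∅ then 1 - t else 0, fun C hC => ?_⟩
    rw [sum_ite_col _ ∅ h0, if_pos (empty_subset C), if_pos (disjoint_empty_left C), if_pos (hall C hC)]; ring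
  by_cases hS𝒞 : S ∈ 𝒞
  · -- the top is present; `ℬ'` = the blocks present
    set ℬ' : Finset (Finset α) := 𝒞.erase S with hℬ'def
    have hℬ'sub : ℬ' ⊆ ℬ := fun B hB => by
      have h1 := mem_erase.mp hB
      exact (mem_insert.mp (h𝒞 h1.2)).resolve_left h1.1
    have hℬ'𝒞 : ∀ B ∈ ℬ', B ∈ 𝒞 := fun B hB => (mem_erase.mp hB).2
    have hℬ'ne : ∀ B ∈ ℬ', B ≠ S := fun B hB => (mem_erase.mp hB).1
    have hmem𝒞 : ∀ C ∈ 𝒞, C = S ∨ C ∈ ℬ' := fun C hC => by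
      by_cases h : C = S
      · exact Or.inl h
      · exact Or.inr (mem_erase.mpr ⟨h, hC⟩)
    have hSD : ∀ B ∈ ℬ', S \ B ∈ 𝒞 \\ 𝒞 := fun B hB => mem_diffs.mpr ⟨S, hS𝒞, B, hℬ'𝒞 B hB, rfl⟩
    by_cases hℬ'e : ℬ' = ∅
    · -- `𝒞 = {S}`
      refine single S hS𝒞 fun C hC => ?_
      rcases hmem𝒞 C hC with h | h
      · exact h
      · rw [hℬ'e] at h; exact absurd h (notMem_empty C)
    obtain ⟨B₀, hB₀⟩ := nonempty_iff_ne_empty.mpr hℬ'e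
    by_cases hone : ∀ B ∈ ℬ', B = B₀
    · -- `𝒞 = {B₀, S}`: certificate `(-t) e_∅ + (1 + t) e_{S \ B₀}` for `S` (exponent 1)
      refine ⟨S, hS𝒞, 1, fun W => (if W = ∅ then -t else 0) + (if W = S \ B₀ then 1 + t else 0),
        fun C hC => ?_⟩
      have hev : ∀ g : Finset α → K, ∑ W ∈ 𝒞 \\ 𝒞,
          ((if W = ∅ then -t else 0) + (if W = S \ B₀ then 1 + t else 0)) * g W =
          -t * g ∅ + (1 + t) * g (S \ B₀) := by
        intro g
        simp only [add_mul, sum_add_distrib]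
        rw [sum_ite_col _ ∅ h0, sum_ite_col _ (S \ B₀) (hSD B₀ hB₀)]
        ring
      rw [hev]
      rcases hmem𝒞 C hC with rfl | hCℬ'
      · rw [if_pos (empty_subset _), if_pos (disjoint_empty_left _), if_pos sdiff_subset,
          if_neg (F6 B₀ (hℬ'sub hB₀)), if_pos rfl]; ring
      · have hCB : C = B₀ := hone C hCℬ'
        subst hCB
        rw [if_pos (empty_subset _), if_pos (disjoint_empty_left _),
          if_neg (F3 C (hℬ'sub hCℬ') C (hℬ'sub hCℬ')), if_pos disjoint_sdiff_self_left,
          if_neg (hℬ'ne C hCℬ')]; ring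
    · -- at least two blocks: the integral exponent-2 certificate for `S`
      push Not at hone
      obtain ⟨B₁, hB₁, hB₁₀⟩ := hone
      have hBD : ∀ B ∈ ℬ', B ∈ 𝒞 \\ 𝒞 := by
        intro B hB
        have hex : ∃ B' ∈ ℬ', B' ≠ B := by
          by_cases h : B = B₀
          · exact ⟨B₁, hB₁, fun h' => hB₁₀ (h'.trans h)⟩
          · exact ⟨B₀, hB₀, fun h' => h h'.symm⟩
        obtain ⟨B', hB', hB'B⟩ := hex
        refine mem_diffs.mpr ⟨B, hℬ'𝒞 B hB, B', hℬ'𝒞 B' hB', ?_⟩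
        exact (hdisj B (hℬ'sub hB) B' (hℬ'sub hB') (Ne.symm hB'B)).sdiff_eq_left
      set r : K := (#ℬ' : K) with hrdef
      refine ⟨S, hS𝒞, 2, fun W => (if W = ∅ then (1 + t) * (1 + (r - 2) * t + t * t) else 0) +
        ∑ B ∈ ℬ', ((if W = B then -((1 + t) ^ 2) else 0) + (if W = S \ B then (1 - t) * (1 + t) ^ 2 else 0)),
        fun C hC => ?_⟩
      have hev : ∀ g : Finset α → K, ∑ W ∈ 𝒞 \\ 𝒞,
          ((if W = ∅ then (1 + t) * (1 + (r - 2) * t + t * t) else 0) +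
            ∑ B ∈ ℬ', ((if W = B then -((1 + t) ^ 2) else 0) +
              (if W = S \ B then (1 - t) * (1 + t) ^ 2 else 0))) * g W =
          (1 + t) * (1 + (r - 2) * t + t * t) * g ∅ +
            ∑ B ∈ ℬ', (-((1 + t) ^ 2) * g B + (1 - t) * (1 + t) ^ 2 * g (S \ B)) := by
        intro g
        have e1 : ∑ W ∈ 𝒞 \\ 𝒞,
            ((if W = ∅ then (1 + t) * (1 + (r - 2) * t + t * t) else 0) +
              ∑ B ∈ ℬ', ((if W = B then -((1 + t) ^ 2) else 0) +
                (if W = S \ B then (1 - t) * (1 + t) ^ 2 else 0))) * g W =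
            ∑ W ∈ 𝒞 \\ 𝒞, (if W = ∅ then (1 + t) * (1 + (r - 2) * t + t * t) else 0) * g W +
              ∑ W ∈ 𝒞 \\ 𝒞, (∑ B ∈ ℬ', ((if W = B then -((1 + t) ^ 2) else 0) +
                (if W = S \ B then (1 - t) * (1 + t) ^ 2 else 0))) * g W := by
          rw [← sum_add_distrib]
          exact sum_congr rfl fun W _ => by ring
        rw [e1, sum_ite_col _ ∅ h0, sum_sum_col]
        congr 1
        refine sum_congr rfl fun B hB => ?_
        have e2 : ∑ W ∈ 𝒞 \\ 𝒞, ((if W = B then -((1 + t) ^ 2) else 0) +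
            (if W = S \ B then (1 - t) * (1 + t) ^ 2 else 0)) * g W =
            ∑ W ∈ 𝒞 \\ 𝒞, (if W = B then -((1 + t) ^ 2) else 0) * g W +
              ∑ W ∈ 𝒞 \\ 𝒞, (if W = S \ B then (1 - t) * (1 + t) ^ 2 else 0) * g W := by
          rw [← sum_add_distrib]
          exact sum_congr rfl fun W _ => by ring
        rw [e2, sum_ite_col _ B (hBD B hB), sum_ite_col _ (S \ B) (hSD B hB)]
      rw [hev]
      rcases hmem𝒞 C hC with rfl | hCℬ'
      · -- row `S`: every block and co-block lies in `S` and meets `S`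
        have e3 : ∑ B ∈ ℬ', (-((1 + t) ^ 2) * ((if B ⊆ C then (1 : K) else 0) +
            t * (if Disjoint B C then (1 : K) else 0)) +
            (1 - t) * (1 + t) ^ 2 * ((if C \ B ⊆ C then (1 : K) else 0) +
              t * (if Disjoint (C \ B) C then (1 : K) else 0))) =
            ∑ B ∈ ℬ', (-((1 + t) ^ 2) + (1 - t) * (1 + t) ^ 2) := by
          refine sum_congr rfl fun B hB => ?_
          rw [if_pos (hBS B (hℬ'sub hB)).subset, if_neg (F5 B (hℬ'sub hB)), if_pos sdiff_subset,
            if_neg (F6 B (hℬ'sub hB))]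
          ring
        rw [e3, sum_const, nsmul_eq_mul, if_pos (empty_subset _), if_pos (disjoint_empty_left _), if_pos rfl]
        ring
      · -- row of a block `C`
        have hCℬ : C ∈ ℬ := hℬ'sub hCℬ'
        have e3 : ∑ B ∈ ℬ', (-((1 + t) ^ 2) * ((if B ⊆ C then (1 : K) else 0) +
            t * (if Disjoint B C then (1 : K) else 0)) +
            (1 - t) * (1 + t) ^ 2 * ((if S \ B ⊆ C then (1 : K) else 0) +
              t * (if Disjoint (S \ B) C then (1 : K) else 0))) =
            ∑ B ∈ ℬ', (if B = C then (-((1 + t) ^ 2) + (1 - t) * (1 + t) ^ 2 * t) else -((1 + t) ^ 2) * t) := by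
          refine sum_congr rfl fun B hB => ?_
          have hBℬ : B ∈ ℬ := hℬ'sub hB
          rw [if_congr (F1 B hBℬ C hCℬ) rfl rfl, if_congr (F2 B hBℬ C hCℬ) rfl rfl, if_neg (F3 B hBℬ C hCℬ),
            if_congr (F4 B hBℬ C hCℬ) rfl rfl]
          by_cases h : B = C
          · simp only [if_pos h, if_neg (not_not.mpr h)]; ring
          · simp only [if_neg h, if_pos h]; ring
        rw [e3, sum_ite_eq_add_card ℬ' C hCℬ', if_pos (empty_subset _), if_pos (disjoint_empty_left _),
          if_neg (hℬ'ne C hCℬ')]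
        ring
  · -- no top: `𝒞` is a packing
    have h𝒞ℬ : 𝒞 ⊆ ℬ := fun C hC => (mem_insert.mp (h𝒞 hC)).resolve_left (fun h => hS𝒞 (h ▸ hC))
    obtain ⟨B₀, hB₀⟩ := h𝒞ne
    by_cases hone : ∀ B ∈ 𝒞, B = B₀
    · exact single B₀ hB₀ hone
    · push Not at hone
      obtain ⟨B₁, hB₁, hB₁₀⟩ := hone
      have hB₀D : B₀ ∈ 𝒞 \\ 𝒞 := mem_diffs.mpr ⟨B₀, hB₀, B₁, hB₁,
        (hdisj B₀ (h𝒞ℬ hB₀) B₁ (h𝒞ℬ hB₁) (Ne.symm hB₁₀)).sdiff_eq_left⟩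
      refine ⟨B₀, hB₀, 1, fun W => (if W = ∅ then -t else 0) + (if W = B₀ then 1 + t else 0),
        fun C hC => ?_⟩
      have hev : ∀ g : Finset α → K, ∑ W ∈ 𝒞 \\ 𝒞,
          ((if W = ∅ then -t else 0) + (if W = B₀ then 1 + t else 0)) * g W = -t * g ∅ + (1 + t) * g B₀ := by
        intro g
        simp only [add_mul, sum_add_distrib]
        rw [sum_ite_col _ ∅ h0, sum_ite_col _ B₀ hB₀D]
        ring
      rw [hev, if_pos (empty_subset _), if_pos (disjoint_empty_left _),
        if_congr (F1 B₀ (h𝒞ℬ hB₀) C (h𝒞ℬ hC)) rfl rfl, if_congr (F2 B₀ (h𝒞ℬ hB₀) C (h𝒞ℬ hC)) rfl rfl]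
      by_cases h : B₀ = C
      · rw [if_pos h, if_neg (not_not.mpr h), if_pos h.symm]; ring
      · rw [if_neg h, if_pos h, if_neg (Ne.symm h)]; ring

end OrderedDifferences

end Summit.CriticalPhenomena.PercolationContinuityZ3.Theorems
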